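import Mathlib
import HarnessLib
import Literature.Analysis.FluidPDE.LocalBiotSavartCalculus
import Literature.Analysis.FluidPDE.LambFormCurlKernel
import Literature.Analysis.FluidPDE.VectorCalculusProofs
import Summits.NavierStokesRegularity.NavierStokesRegularity.Theorems.UnthreadedRigidityDoorUnthreadedRigidityVirialHornShellCalculus
import Summits.NavierStokesRegularity.NavierStokesRegularity.Theorems.UnthreadedRigidityDoorUnthreadedRigidityVirialHornDegreeTwo
import Summits.NavierStokesRegularity.NavierStokesRegularity.Theorems.UnthreadedRigidityDoorUnthreadedRigidityThreadingJetsDefs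
import Literature.Analysis.FluidPDE.HyperbolicDSSOrbit

/-!
# Route `UnthreadedRigidityDoor`, item `UnthreadedRigidity` (W2, stmt-NavierStokesRegularity-27585) — LINES g10-2 / g11-1:
# EXPLICIT SHELLS, THEIR TOROIDAL VORTICITY, AND THE ORDER-ONE SILENCE OF SEPARABLE DATA (LEMMA SEP, L-part)

For a smooth radial profile `h(|y|²)` and a solid harmonic `Y` of degree `l ≥ 1` (`…VirialHorn.IsSolidHarmonic`), the poloidal shell
`u₀ = curl curl ((h(|y|²) Y(y)) y)` (the line's `sepShellL`/`sepShell`, centred) is computed EXPLICITLY and its curls are shown to be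
TOROIDAL:
* `curl_curl_shell_apply` — `u₀ = (2|y|²h′ + (l+1)h) ∇Y − (2 l h′ Y) y` (`= α∇Y − βY y`, `α = rH′ + (l+1)H`, `β = lH′/r`);
* `curl_explicitShell_apply` — `curl (a(|y|²)∇Y − (b(|y|²)Y) y) = −(2a′ + b)(|y|²) (∇Y × y)`;
* `exists_curl_curl_curl_shell` — hence `ω₀ = curl u₀ = −c(|y|²)(∇Y × y)` with a smooth `c`: the vorticity of a shell is TOROIDAL
  (tangent to spheres and orthogonal to `∇Y`), and it is again minus the curl of a shell potential `(c(|y|²) Y) y` (`curl_shell_eq`);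
* ★ `inner_curl_fluxOne_shell_eq_zero` — the FORMAL FIRST JET of the threading flux of a smooth divergence-free shell vanishes:
  `⟪curl (Δu₀ − (u₀·∇)u₀)(y), y⟫ = 0`.  Proof (no Laplacian product rules): `Δu₀ = −curl ω₀` (div-free, `curl_curl_eq_neg_laplacian`),
  and `curl curl ω₀` is toroidal again (two applications of the bullet above); the Lamb form `(u₀·∇)u₀ = ω₀ × u₀ + ∇(|u₀|²/2)`
  (`convect_self_eq_cross_curl_add_gradient`) leaves `⟪curl(ω₀ × u₀), y⟫ = −D⟪u₀, y⟫[ω₀]` (`curl_cross_apply`, `ω₀` tangent and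
  divergence free), and `⟪u₀, y⟫ = l(l+1) h(|y|²) Y` (`inner_curl_curl_shell_self`) has zero derivative along `ω₀ ⊥ y, ∇Y`;
* `sepShellL_eq_comp_sub`, `sepShellL_apply_add` — the shell about any centre `x₀` is the translate of the centred one; its explicit value;
* ★ `fluxJetOne_sepShellL_eq_zero` — the same about any centre `x₀` for the line's `sepShellL H Y x₀` with `VirialAdmissible l H`,
  i.e. LEMMA SEP (order-one silence of separable data) in EVERY degree, with `fluxJetOne` spelled out; the by-name `l = 2` slice
  statement `ThreadingJets.SeparableSliceOrderOneSilence` (ns-crc-p1 g8's Defs) follows in one line once that module is in the tree.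

HONEST LABEL: explicit-field calculus (an L-part) on RUNG lines about SPECIAL separable data; `UnthreadedRigidity` (27585), W2 and NS
regularity remain OPEN; nothing here is a statement about solutions of the Navier–Stokes equations.
`--supports stmt-NavierStokesRegularity-27585` (helper); ns-crc-p2 g8.  [cite: MajdaBertozziCUP2002, §1.1 (vector identities), §2.1 (Lamb form)]
-/

-- the summit and its single sub-problem share the name (CONVENTIONS §1)
set_option linter.dupNamespace false

namespace Summit.NavierStokesRegularity.NavierStokesRegularity.Theorems.UnthreadedRigidity.VirialHorn

open scoped Topology Laplacian
open Filter Set Function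
open Summit.NavierStokesRegularity.NavierStokesRegularity.Theorems.UnthreadedRigidity.ProfileHorn (E3)
open Literature.Analysis.FluidPDE

/-! ## §1 Explicit shells and their toroidal vorticity -/

/-- `⟪a × b, b⟫ = 0`. [folklore] -/
theorem inner_cross_self_right (a b : E3) : inner ℝ (cross a b) b = 0 := by
  simp only [cross, PiLp.inner_apply, RCLike.inner_apply, conj_trivial, Fin.sum_univ_three,
    cross_apply, Matrix.cons_val_zero, Matrix.cons_val_one, Matrix.cons_val_two,
    Matrix.head_cons, Matrix.tail_cons]
  ring

/-- differentiability of `y ↦ h(|y|²)`. [folklore] -/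
theorem differentiableAt_radial {h : ℝ → ℝ} (hh : Differentiable ℝ h) (y : E3) :
    DifferentiableAt ℝ (fun z : E3 => h (‖z‖ ^ 2)) y :=
  (hh (‖y‖ ^ 2)).comp y ((contDiff_norm_sq ℝ (n := 1)).differentiable one_ne_zero).differentiableAt

/-- `curl (∇Y × y) = (l+1) ∇Y` for a solid harmonic of degree `l` (`= D∇Y[y] + 2∇Y − (ΔY) y`). [folklore] -/
theorem IsSolidHarmonic.curl_cross_gradient_self {l : ℕ} {Y : E3 → ℝ} (hY : IsSolidHarmonic l Y) (y : E3) :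
    curl (fun z : E3 => cross (gradient Y z) z) y = ((l : ℝ) + 1) • gradient Y y := by
  have hgd : DifferentiableAt ℝ (gradient Y) y := (hY.contDiff_gradient.differentiable (by simp)) y
  have hid : DifferentiableAt ℝ (fun z : E3 => z) y := differentiableAt_id
  have h : fderiv ℝ (fun z : E3 => z) y = ContinuousLinearMap.id ℝ E3 := fderiv_id
  have hdiv : VectorCalculus.divergence (fun z : E3 => z) y = 3 := by
    rw [VectorCalculus.divergence, h]
    simp [LinearMap.trace_id, finrank_euclideanSpace]
  rw [curl_cross_apply hgd hid, hdiv, hY.divergence_gradient, h, ContinuousLinearMap.id_apply,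
    hY.hessian_apply_self, zero_smul, sub_zero]
  module

/-- THE EXPLICIT SHELL: `curl curl ((h(|y|²) Y(y)) y) = (2|y|²h′ + (l+1)h) ∇Y − (2 l h′ Y) y` (`h ∈ C¹`, `Y` a solid harmonic of
degree `l`; with `H(r) = h(r²)`: `u₀ = α∇Y − βY y`, `α = rH′ + (l+1)H`, `β = lH′/r`). [folklore] -/
theorem curl_curl_shell_apply {h : ℝ → ℝ} (hh : ContDiff ℝ 1 h) {l : ℕ} {Y : E3 → ℝ} (hY : IsSolidHarmonic l Y)
    (y : E3) :
    curl (curl (fun z : E3 => (h (‖z‖ ^ 2) * Y z) • z)) y =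
      (2 * ‖y‖ ^ 2 * deriv h (‖y‖ ^ 2) + ((l : ℝ) + 1) * h (‖y‖ ^ 2)) • gradient Y y
        - (2 * (l : ℝ) * deriv h (‖y‖ ^ 2) * Y y) • y := by
  have hhd : Differentiable ℝ h := hh.differentiable (by simp)
  have hYd : Differentiable ℝ Y := hY.contDiff.differentiable (by simp)
  rw [curl_shell_eq hhd hYd]
  have hgd : DifferentiableAt ℝ (gradient Y) y := (hY.contDiff_gradient.differentiable (by simp)) y
  have hV : DifferentiableAt ℝ (fun z : E3 => cross (gradient Y z) z) y :=
    (hasFDerivAt_cross hgd.hasFDerivAt (hasFDerivAt_id y)).differentiableAt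
  rw [curl_smul (differentiableAt_radial hhd y) hV, curlCLM_smulRight, ← gradient, gradient_radial hhd,
    hY.curl_cross_gradient_self, cross_smul_left, cross_cross_right, real_inner_self_eq_norm_sq,
    hY.inner_self_gradient]
  module

/-- THE TOROIDAL VORTICITY OF A SHELL: `curl (a(|y|²)∇Y − (b(|y|²)Y) y) = −(2a′ + b)(|y|²) (∇Y × y)`
(`∇a(|y|²) = 2a′ y`, `curl ∇Y = 0`, `curl((bY) y) = ∇(bY) × y = b ∇Y × y`). [folklore] -/
theorem curl_explicitShell_apply {a b : ℝ → ℝ} (ha : ContDiff ℝ 1 a) (hb : ContDiff ℝ 1 b) {l : ℕ} {Y : E3 → ℝ}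
    (hY : IsSolidHarmonic l Y) (y : E3) :
    curl (fun z : E3 => a (‖z‖ ^ 2) • gradient Y z - (b (‖z‖ ^ 2) * Y z) • z) y =
      -((2 * deriv a (‖y‖ ^ 2) + b (‖y‖ ^ 2)) • cross (gradient Y y) y) := by
  have had : Differentiable ℝ a := ha.differentiable (by simp)
  have hbd : Differentiable ℝ b := hb.differentiable (by simp)
  have hYd : Differentiable ℝ Y := hY.contDiff.differentiable (by simp)
  have hgd : DifferentiableAt ℝ (gradient Y) y := (hY.contDiff_gradient.differentiable (by simp)) y
  have hA : DifferentiableAt ℝ (fun z : E3 => a (‖z‖ ^ 2)) y := differentiableAt_radial had y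
  have hB : DifferentiableAt ℝ (fun z : E3 => b (‖z‖ ^ 2)) y := differentiableAt_radial hbd y
  have h1 : DifferentiableAt ℝ (fun z : E3 => a (‖z‖ ^ 2) • gradient Y z) y := hA.smul hgd
  have h2 : DifferentiableAt ℝ (fun z : E3 => (b (‖z‖ ^ 2) * Y z) • z) y :=
    (hB.mul (hYd y)).smul differentiableAt_id
  rw [curl_sub h1 h2]
  have hC2 : ContDiff ℝ 2 Y := hY.contDiff.of_le (by norm_cast)
  have hcurl_grad : curl (gradient Y) y = 0 := curl_gradient_eq_zero_holds Y hC2 y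
  have hBY : DifferentiableAt ℝ (fun z : E3 => b (‖z‖ ^ 2) * Y z) y := hB.mul (hYd y)
  rw [curl_smul hA hgd, hcurl_grad, smul_zero, zero_add, curlCLM_smulRight, ← gradient, gradient_radial had,
    cross_smul_left, curl_smul_self hBY]
  have hgrad : gradient (fun z : E3 => b (‖z‖ ^ 2) * Y z) y =
      b (‖y‖ ^ 2) • gradient Y y + Y y • gradient (fun z : E3 => b (‖z‖ ^ 2)) y := by
    rw [gradient, fderiv_fun_mul hB (hYd y), map_add, map_smul, map_smul]
    rfl
  rw [hgrad, gradient_radial hbd]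
  have hyy : cross y y = 0 := by
    ext i
    fin_cases i <;> simp [cross]
  have hsw : cross y (gradient Y y) = -cross (gradient Y y) y := cross_swap _ _
  rw [← crossCLM_apply (b (‖y‖ ^ 2) • gradient Y y + Y y • (2 * deriv b (‖y‖ ^ 2)) • y) y, map_add,
    add_apply, crossCLM_apply, crossCLM_apply, cross_smul_left, cross_smul_left,
    cross_smul_left, hyy, smul_zero, smul_zero, add_zero, hsw]
  module

/-- Smoothness bookkeeping: the derivative of a smooth one-variable function is smooth. [folklore] -/
theorem contDiff_deriv_of_contDiff_top {h : ℝ → ℝ} (hh : ContDiff ℝ (⊤ : ℕ∞) h) :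
    ContDiff ℝ (⊤ : ℕ∞) (deriv h) := by
  have := hh.iterate_deriv 1
  simpa using this

/-- THE VORTICITY OF A SHELL IS TOROIDAL: for a smooth profile `h` and a solid harmonic `Y` there is a smooth `c` with
`curl (curl curl ((h(|y|²) Y) y)) = −c(|y|²) (∇Y × y)` (explicitly `c = 2a′ + b`, `a(s) = 2sh′ + (l+1)h`, `b = 2lh′`). [folklore] -/
theorem exists_curl_curl_curl_shell {h : ℝ → ℝ} (hh : ContDiff ℝ (⊤ : ℕ∞) h) {l : ℕ} {Y : E3 → ℝ}
    (hY : IsSolidHarmonic l Y) :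
    ∃ c : ℝ → ℝ, ContDiff ℝ (⊤ : ℕ∞) c ∧
      curl (curl (curl (fun z : E3 => (h (‖z‖ ^ 2) * Y z) • z))) =
        fun y : E3 => -(c (‖y‖ ^ 2) • cross (gradient Y y) y) := by
  have hh' : ContDiff ℝ (⊤ : ℕ∞) (deriv h) := contDiff_deriv_of_contDiff_top hh
  set a : ℝ → ℝ := fun s => 2 * s * deriv h s + ((l : ℝ) + 1) * h s with ha_def
  set b : ℝ → ℝ := fun s => 2 * (l : ℝ) * deriv h s with hb_def
  have ha : ContDiff ℝ (⊤ : ℕ∞) a :=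
    ((contDiff_const.mul contDiff_id).mul hh').add (contDiff_const.mul hh)
  have hb : ContDiff ℝ (⊤ : ℕ∞) b := contDiff_const.mul hh'
  refine ⟨fun s => 2 * deriv a s + b s, (contDiff_const.mul (contDiff_deriv_of_contDiff_top ha)).add hb, ?_⟩
  have hshell : curl (curl (fun z : E3 => (h (‖z‖ ^ 2) * Y z) • z)) =
      fun z : E3 => a (‖z‖ ^ 2) • gradient Y z - (b (‖z‖ ^ 2) * Y z) • z := by
    funext z
    rw [curl_curl_shell_apply (hh.of_le (by norm_cast)) hY z]
  rw [hshell]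
  funext y
  rw [curl_explicitShell_apply (ha.of_le (by norm_cast)) (hb.of_le (by norm_cast)) hY y]

/-! ## §2 Order-one silence of a smooth divergence-free shell (centred) -/

/-- TANGENCY DIFFERENTIATED: if `⟪ω z, z⟫ = 0` for all `z` and `ω` is differentiable at `y`, then `⟪Dω(y) v, y⟫ = −⟪ω y, v⟫`. [folklore] -/
theorem inner_fderiv_of_tangent {ω : E3 → E3} {y : E3} (hω : DifferentiableAt ℝ ω y)
    (htan : ∀ z, inner ℝ (ω z) z = 0) (v : E3) :
    inner ℝ (fderiv ℝ ω y v) y = -inner ℝ (ω y) v := by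
  have hn : HasFDerivAt (fun z => inner ℝ (ω z) z)
      ((fderivInnerCLM ℝ (ω y, y)).comp ((fderiv ℝ ω y).prod (ContinuousLinearMap.id ℝ E3))) y :=
    hω.hasFDerivAt.inner ℝ (hasFDerivAt_id y)
  have hzero : fderiv ℝ (fun z => inner ℝ (ω z) z) y = 0 := by
    rw [show (fun z => inner ℝ (ω z) z) = fun _ => (0 : ℝ) from funext htan]
    exact fderiv_const_apply 0
  have h1 := congrArg (fun L : E3 →L[ℝ] ℝ => L v) (hn.fderiv.symm.trans hzero)
  simp only [ContinuousLinearMap.comp_apply, ContinuousLinearMap.prod_apply, ContinuousLinearMap.id_apply,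
    fderivInnerCLM_apply, zero_apply] at h1
  linarith [real_inner_comm (fderiv ℝ ω y v) y, h1]

/-- ORDER-ONE SILENCE OF A SHELL (centred): for a smooth divergence-free shell `P = curl curl ((h(|y|²)Y) y)` (`h` smooth, `Y` a solid
harmonic of degree `l ≥ 1`), `⟪curl (ΔP − (P·∇)P)(y), y⟫ = 0`.  (`ΔP = −curl ω`, `ω = curl P` toroidal with `curl curl ω` toroidal;
Lamb form; `⟪curl(ω × P), y⟫ = −D⟪P, y⟫[ω] = 0`.) [cite: MajdaBertozziCUP2002, §1.1, §2.1] -/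
theorem inner_curl_fluxOne_shell_eq_zero {h : ℝ → ℝ} (hh : ContDiff ℝ (⊤ : ℕ∞) h) {l : ℕ} {Y : E3 → ℝ}
    (hY : IsSolidHarmonic l Y) (hl : 1 ≤ l) {P : E3 → E3}
    (hPe : P = curl (curl (fun z : E3 => (h (‖z‖ ^ 2) * Y z) • z)))
    (hP : ContDiff ℝ (⊤ : ℕ∞) P) (hdiv : VectorCalculus.IsDivFree P) (y : E3) :
    inner ℝ (curl (fun z : E3 => (Δ P) z - convect P P z) y) y = 0 := by
  obtain ⟨ω, hω_def⟩ : ∃ ω : E3 → E3, ω = curl P := ⟨_, rfl⟩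
  -- the toroidal form of `ω` and of `curl curl ω`
  obtain ⟨c, hc, hωc⟩ := exists_curl_curl_curl_shell hh hY
  have hω_eq : ω = fun y : E3 => -(c (‖y‖ ^ 2) • cross (gradient Y y) y) := by
    rw [hω_def, hPe]
    exact hωc
  have hcd : Differentiable ℝ c := hc.differentiable (by simp)
  have hYd : Differentiable ℝ Y := hY.contDiff.differentiable (by simp)
  have hω_shell : ω = fun y : E3 => -curl (fun z : E3 => (c (‖z‖ ^ 2) * Y z) • z) y := by
    rw [hω_eq, curl_shell_eq hcd hYd]
  obtain ⟨c₂, -, hc₂⟩ := exists_curl_curl_curl_shell hc hY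
  have hcc : ∀ z : E3, inner ℝ (curl (curl ω) z) z = 0 := by
    intro z
    have e1 : curl ω = fun w => -curl (curl (fun z : E3 => (c (‖z‖ ^ 2) * Y z) • z)) w := by
      funext w
      rw [hω_shell]
      exact curl_neg _ w
    have e2 : curl (curl ω) z = -curl (curl (curl (fun z : E3 => (c (‖z‖ ^ 2) * Y z) • z))) z := by
      rw [e1]
      exact curl_neg _ z
    rw [e2]
    simp only [hc₂, neg_neg, inner_smul_left, conj_trivial, inner_cross_self_right, mul_zero]
  -- regularity
  have hP2 : ContDiff ℝ 2 P := hP.of_le (by norm_cast)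
  have hPd : Differentiable ℝ P := hP.differentiable (by simp)
  have hωs : ContDiff ℝ (⊤ : ℕ∞) ω := by
    have : ContDiff ℝ ((⊤ : ℕ∞) + 1) P := by simpa using hP
    rw [hω_def]
    exact contDiff_curl this
  have hωd : Differentiable ℝ ω := hωs.differentiable (by simp)
  have hcωd : Differentiable ℝ (curl ω) := by
    have : ContDiff ℝ ((⊤ : ℕ∞) + 1) ω := by simpa using hωs
    exact (contDiff_curl this).differentiable (by simp)
  -- `ΔP = −curl ω` and the Lamb form
  have hlap : (fun z : E3 => (Δ P) z) = fun z => -curl ω z := by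
    funext z
    rw [hω_def, curl_curl_eq_neg_laplacian hP2 hdiv z, neg_neg]
  set q : E3 → ℝ := fun z => ‖P z‖ ^ 2 / 2 with hq_def
  have hq : ContDiff ℝ 2 q := by
    have : ContDiff ℝ 2 (fun z : E3 => ‖P z‖ ^ 2) := hP2.norm_sq ℝ
    exact this.div_const 2
  have hlamb : (fun z : E3 => convect P P z) = fun z => cross (ω z) (P z) + gradient q z := by
    funext z
    rw [hω_def]
    exact convect_self_eq_cross_curl_add_gradient (hPd z)
  have hinner : (fun z : E3 => (Δ P) z - convect P P z) = fun z => -curl ω z - (cross (ω z) (P z) + gradient q z) := by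
    funext z
    have e1 := congrFun hlap z
    have e2 := congrFun hlamb z
    rw [e1, e2]
  -- differentiability of the three pieces
  have hgq : Differentiable ℝ (gradient q) := by
    have h1 : ContDiff ℝ 1 (fderiv ℝ q) := hq.fderiv_right (m := 1) (by norm_cast)
    exact (InnerProductSpace.toDual ℝ E3).symm.differentiable.comp (h1.differentiable (by simp))
  have hcrossd : Differentiable ℝ (fun z : E3 => cross (ω z) (P z)) := fun z =>
    (hasFDerivAt_cross (hωd z).hasFDerivAt (hPd z).hasFDerivAt).differentiableAt
  have hneg : DifferentiableAt ℝ (fun z : E3 => -curl ω z) y := (hcωd y).neg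
  have hadd : DifferentiableAt ℝ (fun z : E3 => cross (ω z) (P z) + gradient q z) y := (hcrossd y).add (hgq y)
  have hcurl_split : curl (fun z : E3 => -curl ω z - (cross (ω z) (P z) + gradient q z)) y =
      -curl (curl ω) y - (curl (fun z : E3 => cross (ω z) (P z)) y + curl (gradient q) y) := by
    rw [curl_sub hneg hadd, curl_neg, curl_add (hcrossd y) (hgq y)]
  rw [hinner, hcurl_split, curl_gradient_eq_zero_holds q hq y, add_zero, inner_sub_left, inner_neg_left, hcc y,
    neg_zero, zero_sub, neg_eq_zero]
  -- `⟪curl (ω × P) y, y⟫ = −D⟪P, ·⟫(y)[ω y] = 0`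
  have htan : ∀ z : E3, inner ℝ (ω z) z = 0 := fun z => by
    rw [hω_eq]
    simp only [inner_neg_left, inner_smul_left, inner_cross_self_right, mul_zero, neg_zero]
  have hdivω : VectorCalculus.divergence ω y = 0 := by
    rw [hω_def]
    exact divergence_curl_eq_zero_holds P hP2 y
  rw [curl_cross_apply (hωd y) (hPd y), hdivω, hdiv y, zero_smul, zero_smul, sub_zero, add_zero, inner_sub_left,
    inner_fderiv_of_tangent (hωd y) htan]
  -- `⟪DP(y)(ω y), y⟫ + ⟪P y, ω y⟫ = D(⟪P ·, ·⟫)(y)(ω y)` and `⟪P z, z⟫ = l(l+1) h(|z|²) Y z`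
  have hm : (fun z : E3 => inner ℝ (P z) z) = fun z => ((l : ℝ) * ((l : ℝ) + 1)) * (h (‖z‖ ^ 2) * Y z) := by
    funext z
    rw [hPe]
    exact inner_curl_curl_shell_self (hh.of_le (by norm_cast)) hY hl z
  have hmd : HasFDerivAt (fun z : E3 => inner ℝ (P z) z)
      ((fderivInnerCLM ℝ (P y, y)).comp ((fderiv ℝ P y).prod (ContinuousLinearMap.id ℝ E3))) y :=
    (hPd y).hasFDerivAt.inner ℝ (hasFDerivAt_id y)
  have hkey : inner ℝ (fderiv ℝ P y (ω y)) y + inner ℝ (P y) (ω y) =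
      fderiv ℝ (fun z : E3 => ((l : ℝ) * ((l : ℝ) + 1)) * (h (‖z‖ ^ 2) * Y z)) y (ω y) := by
    rw [← hm, hmd.fderiv]
    simp only [ContinuousLinearMap.comp_apply, ContinuousLinearMap.prod_apply, ContinuousLinearMap.id_apply,
      fderivInnerCLM_apply]
    ring
  -- the derivative of `h(|z|²) Y z` along `ω y ⊥ y, ∇Y`
  have hhd : Differentiable ℝ h := hh.differentiable (by simp)
  have hH : HasFDerivAt (fun z : E3 => h (‖z‖ ^ 2)) (deriv h (‖y‖ ^ 2) • (2 • innerSL ℝ y)) y :=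
    ((hhd (‖y‖ ^ 2)).hasDerivAt).comp_hasFDerivAt y (hasStrictFDerivAt_norm_sq y).hasFDerivAt
  have hprod : HasFDerivAt (fun z : E3 => h (‖z‖ ^ 2) * Y z)
      (h (‖y‖ ^ 2) • fderiv ℝ Y y + Y y • (deriv h (‖y‖ ^ 2) • (2 • innerSL ℝ y))) y :=
    hH.mul (hYd y).hasFDerivAt
  have hωy : ω y = -(c (‖y‖ ^ 2) • cross (gradient Y y) y) := congrFun hω_eq y
  have h1 : fderiv ℝ Y y (ω y) = 0 := by
    have e : inner ℝ (gradient Y y) (ω y) = fderiv ℝ Y y (ω y) := by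
      rw [gradient, InnerProductSpace.toDual_symm_apply]
    rw [← e, hωy, inner_neg_right, inner_smul_right, real_inner_comm, inner_cross_self_left, mul_zero, neg_zero]
  have h2 : (innerSL ℝ y) (ω y) = 0 := by
    rw [innerSL_apply_apply, hωy, inner_neg_right, inner_smul_right, real_inner_comm, inner_cross_self_right,
      mul_zero, neg_zero]
  have hval : fderiv ℝ (fun z : E3 => ((l : ℝ) * ((l : ℝ) + 1)) * (h (‖z‖ ^ 2) * Y z)) y (ω y) = 0 := by
    rw [fderiv_const_mul hprod.differentiableAt, hprod.fderiv]
    simp [h1, h2]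
  linarith [hkey, hval, real_inner_comm (ω y) (P y)]

/-! ## §3 About any centre: LEMMA SEP in every degree, and the `l = 2` slice statement by name -/

/-- Laplacian of a translate: `Δ(f(· − a))(x) = (Δf)(x − a)` (no differentiability needed). [folklore] -/
theorem laplacian_comp_sub_const {F : Type*} [NormedAddCommGroup F] [NormedSpace ℝ F] (f : E3 → F) (a x : E3) :
    (Δ fun y : E3 => f (y - a)) x = (Δ f) (x - a) := by
  rw [InnerProductSpace.laplacian_eq_iteratedFDeriv_stdOrthonormalBasis,
    InnerProductSpace.laplacian_eq_iteratedFDeriv_stdOrthonormalBasis]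
  simp only [iteratedFDeriv_comp_sub]

/-- THE SHELL ABOUT `x₀` IS THE TRANSLATE OF THE CENTRED SHELL: for a profile with `H(r) = h(r²)` (`r ≥ 0`),
`sepShellL H Y x₀ = (curl curl ((h(|z|²) Y z) z)) ∘ (· − x₀)`. [folklore] -/
theorem sepShellL_eq_comp_sub {H h : ℝ → ℝ} (hHh : ∀ r : ℝ, 0 ≤ r → H r = h (r ^ 2)) (Y : E3 → ℝ) (x₀ : E3) :
    sepShellL H Y x₀ = fun x : E3 => curl (curl (fun z : E3 => (h (‖z‖ ^ 2) * Y z) • z)) (x - x₀) := by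
  have hF : (fun x : E3 => (H ‖x - x₀‖ * Y (x - x₀)) • (x - x₀)) =
      fun x : E3 => (fun z : E3 => (h (‖z‖ ^ 2) * Y z) • z) (x - x₀) := by
    funext x
    rw [hHh ‖x - x₀‖ (norm_nonneg _)]
  unfold sepShellL
  rw [hF, curl_comp_sub_const_fun (fun z : E3 => (h (‖z‖ ^ 2) * Y z) • z) x₀,
    curl_comp_sub_const_fun (curl (fun z : E3 => (h (‖z‖ ^ 2) * Y z) • z)) x₀]

/-- THE SEPARABLE SHELL, EXPLICITLY, about any centre: `sepShellL H Y x₀ (x₀ + y) = (2|y|²h′ + (l+1)h)(|y|²) ∇Y(y) − (2 l h′(|y|²) Y(y)) y`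
for `H(r) = h(r²)`, `h ∈ C¹`, `Y` a solid harmonic of degree `l`. [folklore] -/
theorem sepShellL_apply_add {H h : ℝ → ℝ} (hHh : ∀ r : ℝ, 0 ≤ r → H r = h (r ^ 2)) (hh : ContDiff ℝ 1 h)
    {l : ℕ} {Y : E3 → ℝ} (hY : IsSolidHarmonic l Y) (x₀ y : E3) :
    sepShellL H Y x₀ (x₀ + y) =
      (2 * ‖y‖ ^ 2 * deriv h (‖y‖ ^ 2) + ((l : ℝ) + 1) * h (‖y‖ ^ 2)) • gradient Y y
        - (2 * (l : ℝ) * deriv h (‖y‖ ^ 2) * Y y) • y := by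
  rw [sepShellL_eq_comp_sub hHh Y x₀]
  simp only [add_sub_cancel_left]
  exact curl_curl_shell_apply hh hY y

/-- ★ LEMMA SEP IN EVERY DEGREE (slice form): for a virial-admissible profile `H` and a solid harmonic `Y` of degree `l ≥ 1`, if the
separable shell `u₀ = sepShellL H Y x₀` is smooth and divergence free then its formal first threading jet vanishes identically,
`fluxJetOne u₀ x₀ ≡ 0` (ns-crc-p1 g8's `ThreadingJets.fluxJetOne`). [cite: MajdaBertozziCUP2002, §1.1, §2.1] -/
theorem fluxJetOne_sepShellL_eq_zero {l : ℕ} (hl : 1 ≤ l) {Y : E3 → ℝ} (hY : IsSolidHarmonic l Y) {H : ℝ → ℝ}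
    (hH : VirialAdmissible l H) (x₀ : E3)
    (hs : ContDiff ℝ (⊤ : ℕ∞) (sepShellL H Y x₀))
    (hdiv : VectorCalculus.IsDivFree (sepShellL H Y x₀)) (x : E3) :
    ThreadingJets.fluxJetOne (sepShellL H Y x₀) x₀ x = 0 := by
  obtain ⟨h, hh, hHh⟩ := hH.1
  obtain ⟨P, hPe⟩ : ∃ P : E3 → E3, P = curl (curl (fun z : E3 => (h (‖z‖ ^ 2) * Y z) • z)) := ⟨_, rfl⟩
  -- the shell about `x₀` is the translate of the centred shell `P`
  have hv : sepShellL H Y x₀ = fun x : E3 => P (x - x₀) := by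
    rw [hPe]
    exact sepShellL_eq_comp_sub hHh Y x₀
  -- transfer of the hypotheses to `P`
  have hPv : P = fun y : E3 => sepShellL H Y x₀ (y + x₀) := by
    funext y
    rw [hv]
    simp
  have hP : ContDiff ℝ (⊤ : ℕ∞) P := by
    rw [hPv]
    exact hs.comp (contDiff_id.add contDiff_const)
  have hdivP : VectorCalculus.IsDivFree P := by
    intro y
    have h1 : fderiv ℝ P y = fderiv ℝ (sepShellL H Y x₀) (y + x₀) := by
      rw [hPv, fderiv_comp_add_right]
    have h2 := hdiv (y + x₀)
    unfold VectorCalculus.divergence at h2 ⊢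
    rw [h1]
    exact h2
  -- the jet about `x₀` is the centred jet at `x − x₀`
  have hin1 : ∀ z : E3, (Δ (sepShellL H Y x₀)) z = (Δ P) (z - x₀) := by
    intro z
    rw [hv]
    exact laplacian_comp_sub_const P x₀ z
  have hin2 : ∀ z : E3, convect (sepShellL H Y x₀) (sepShellL H Y x₀) z = convect P P (z - x₀) := by
    intro z
    rw [convect_apply, convect_apply, hv, fderiv_comp_sub]
  obtain ⟨G, hG⟩ : ∃ G : E3 → E3, G = fun w : E3 => (Δ P) w - convect P P w := ⟨_, rfl⟩
  have hin : (fun z : E3 => (Δ (sepShellL H Y x₀)) z - convect (sepShellL H Y x₀) (sepShellL H Y x₀) z) =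
      fun z : E3 => G (z - x₀) := by
    funext z
    rw [hin1 z, hin2 z, hG]
  have hG0 : ∀ y : E3, inner ℝ (curl G y) y = 0 := fun y => by
    rw [hG]
    exact inner_curl_fluxOne_shell_eq_zero hh hY hl hPe hP hdivP y
  unfold ThreadingJets.fluxJetOne
  rw [hin, curl_comp_sub_const_fun G x₀]
  exact hG0 (x - x₀)

/-- ★ LEMMA SEP AT `l = 2`, BY NAME: ns-crc-p1 g8's slice statement `ThreadingJets.SeparableSliceOrderOneSilence` — the formal first
threading jet of a smooth divergence-free separable `l = 2` shell `sepShell H Q x₀` (g10-2 objects: `IsQuadForm Q`, `HornAdmissible H`)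
vanishes identically.  With the dictionary (`separableOrderOneSilence_of_slice`, `…ThreadingJetsSlice`) this gives LEMMA SEP
`ProfileHorn.SeparableOrderOneSilence` as a tree theorem. -/
theorem separableSliceOrderOneSilence : ThreadingJets.SeparableSliceOrderOneSilence := by
  intro Q H x₀ hQ hH hs hdiv x
  exact fluxJetOne_sepShellL_eq_zero (l := 2) (by norm_num) (isSolidHarmonic_quadY hQ)
    (virialAdmissible_two_of_hornAdmissible hH) x₀ hs hdiv x

end Summit.NavierStokesRegularity.NavierStokesRegularity.Theorems.UnthreadedRigidity.VirialHorn
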